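import Summits.PneNP.PneNP.Theorems.ChebyshevTracialDesignLevelColumnSums
import HarnessLib

/-!
# Cell pnp-psdrank, route `ChebyshevTracialDesign`: the exact bi-mode expansion of a family of cuts against the level
# classes of a perfect matching (R1-SKELETON S3 (i), r = 1, every level)

Harmonic backbone, brick 8 (MEMO-7 (C2)). For a family `X` of `t`-cuts (`t = 2l+1`, `2t ≤ n+1`) let
`1_X = Σ_{j ≤ t} (Wᵀ)^{t−j} p_j` be its ladder (harmonic) decomposition (lit's `exists_ladder_decomposition`). Then for EVERY
perfect matching `M` (partner involution `π`) and EVERY level `e₀` (number of `M`-edges inside the cut; `cc = t − 2e₀`):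
  `#{U ∈ X : e_M(U) = e₀} = Σ_{κ ≤ l} (t−2κ)! · σ̃_{2κ}(e₀) · Π_{p_{2κ}}(M)`            (`card_filter_level_eq_bimode`)
with the explicit level coefficients `σ̃` of brick 7 (`…LevelColumnSums`, (★)) and the matching-side functionals
`Π_p(M) = Σ_{T M-closed, |T| = 2κ} p_T` that do NOT depend on the level: the odd layers of `X` never contribute, and the level
profile of every rectangle `X × Y` is `Σ_κ σ̃_{2κ}(c)·b_κ(X,Y)` with `b_κ = (t−2κ)!·Σ_{M ∈ Y} Π_{p_{2κ}}(M)` — the exact form of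
the bi-mode expansion that the design analysis of route `ChebyshevTracialDesign` postulated (p1 N2-SpreadStructure §SNT (2),
"μ_c(R) = μν + Σ_k σ_k(c) β_k, deg_c σ_k = k/2") [cite: Rothvoss2017, §2 (PDF p. 6)]
[cite: GodsilMeagher2015, §15.2 (perfect matching scheme)]. WHAT THIS IS NOT: no bound on the `b_κ` (that is where spreadness /
level-k inequalities enter); nothing on psd rank. Supports crux stmt-PneNP-19878.
-/

set_option linter.dupNamespace false -- `Summit.PneNP.PneNP.…`: summit = sub-problem (D-0017)

noncomputable section

namespace Summit.PneNP.PneNP.Theorems.ChebyshevTracialDesignRectangleBiMode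

open Finset Literature.Combinatorics.AssociationSchemes Literature.Combinatorics.AssociationSchemes.JohnsonHarmonics
open Literature.Barriers.PneNP
open Summit.PneNP.PneNP.Theorems.ChebyshevTracialDesignLevelColumnSums
open Summit.PneNP.PneNP.Theorems.ChebyshevTracialDesignTightColumnSums

variable {n : ℕ}

/-- **A family of `t`-cuts as a sum of layer functions.** For `X ⊆ (t-sets)` with `2t ≤ n+1` there are harmonic `p_j`
(`j ≤ t`) with `1[U ∈ X] = Σ_{j ≤ t} (t−j)! · zeta p_j (U)` on every `t`-set `U`. -/
theorem exists_layer_decomposition {t : ℕ} (ht : 2 * t ≤ n + 1) (X : Finset (Finset (Fin n)))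
    (hX : X ⊆ powersetCard t (univ : Finset (Fin n))) :
    ∃ p : ℕ → (Finset (Fin n) → ℝ), (∀ j, IsHarmonic j (p j)) ∧
      ∀ U ∈ powersetCard t (univ : Finset (Fin n)),
        (if U ∈ X then (1 : ℝ) else 0) = ∑ j ∈ range (t + 1), ((t - j).factorial : ℝ) * zeta (p j) U := by
  classical
  set h : Finset (Fin n) → ℝ := fun S => if S ∈ X then 1 else 0 with hh
  have hhom : IsHomog t h := by
    intro S hS
    simp only [hh]
    rw [if_neg]
    intro hSX
    exact hS (mem_powersetCard.1 (hX hSX)).2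
  obtain ⟨p, hp, hdec⟩ := exists_ladder_decomposition ht hhom
  refine ⟨p, hp, fun U hU => ?_⟩
  have hUt : U.card = t := (mem_powersetCard.1 hU).2
  have := congrFun hdec U
  simp only [hh, Finset.sum_apply] at this
  rw [this]
  refine sum_congr rfl fun j hj => ?_
  have hjt : j ≤ t := by have := mem_range.1 hj; omega
  exact iterate_up_apply_of_isHomog (hp j).1 (by rw [hUt]; omega)

/-- **Counting a family on a level class through its layers.** With `p_j` as above, for every fixed-point-free involution
`π` and level `e₀`: `#{U ∈ X : e_π(U) = e₀} = Σ_{j ≤ t} (t−j)! · Σ_{|U| = t, e_π(U) = e₀} zeta p_j (U)`. -/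
theorem card_filter_level_eq_sum_layers {t : ℕ} (X : Finset (Finset (Fin n)))
    (hX : X ⊆ powersetCard t (univ : Finset (Fin n))) (p : ℕ → (Finset (Fin n) → ℝ))
    (hdec : ∀ U ∈ powersetCard t (univ : Finset (Fin n)),
      (if U ∈ X then (1 : ℝ) else 0) = ∑ j ∈ range (t + 1), ((t - j).factorial : ℝ) * zeta (p j) U)
    (π : Fin n → Fin n) (e₀ : ℕ) :
    ((X.filter fun U => (U.filter fun x => x < π x ∧ π x ∈ U).card = e₀).card : ℝ) =
      ∑ j ∈ range (t + 1), ((t - j).factorial : ℝ) *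
        ∑ U ∈ (powersetCard t (univ : Finset (Fin n))).filter
          (fun U => (U.filter fun x => x < π x ∧ π x ∈ U).card = e₀), zeta (p j) U := by
  classical
  -- the count is the sum of the indicator of `X` over the level class
  have hcount : ((X.filter fun U => (U.filter fun x => x < π x ∧ π x ∈ U).card = e₀).card : ℝ) =
      ∑ U ∈ (powersetCard t (univ : Finset (Fin n))).filter
        (fun U => (U.filter fun x => x < π x ∧ π x ∈ U).card = e₀), (if U ∈ X then (1 : ℝ) else 0) := by
    have hset : X.filter (fun U => (U.filter fun x => x < π x ∧ π x ∈ U).card = e₀) =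
        ((powersetCard t (univ : Finset (Fin n))).filter
          (fun U => (U.filter fun x => x < π x ∧ π x ∈ U).card = e₀)).filter (fun U => U ∈ X) := by
      ext U
      simp only [mem_filter]
      constructor
      · rintro ⟨hUX, hU⟩; exact ⟨⟨hX hUX, hU⟩, hUX⟩
      · rintro ⟨⟨-, hU⟩, hUX⟩; exact ⟨hUX, hU⟩
    rw [hset, card_filter]
    push_cast
    rfl
  rw [hcount]
  rw [sum_congr rfl fun U hU => hdec U (mem_filter.1 hU).1, sum_comm]
  refine sum_congr rfl fun j _ => ?_
  rw [mul_sum]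

/-- **The exact bi-mode expansion** (r = 1, every level). For `X ⊆ ((2l+1)-sets)` with `2(2l+1) ≤ n+1`... (`4l + 2 ≤ n + 1`)
there are harmonic `p_j` such that for EVERY fixed-point-free involution `π` of `Fin n` (every perfect matching) and EVERY
level `e₀`, `#{U ∈ X : e_π(U) = e₀}` is the sum over the EVEN layers `2κ ≤ 2l` (`4κ ≤ n`) of
`(2l+1−2κ)! · σ̃_{2κ}(e₀) · Σ_{T π-closed, |T| = 2κ} (p_{2κ})_T`, with the level coefficient `σ̃` of `…LevelColumnSums`. -/
theorem card_filter_level_eq_bimode {l : ℕ} (hl : 2 * (2 * l + 1) ≤ n + 1) (X : Finset (Finset (Fin n)))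
    (hX : X ⊆ powersetCard (2 * l + 1) (univ : Finset (Fin n))) :
    ∃ p : ℕ → (Finset (Fin n) → ℝ), (∀ j, IsHarmonic j (p j)) ∧
      ∀ (π : Fin n → Fin n), (∀ x, π (π x) = x) → (∀ x, π x ≠ x) → ∀ e₀ : ℕ,
        ((X.filter fun U => (U.filter fun x => x < π x ∧ π x ∈ U).card = e₀).card : ℝ) =
          ∑ κ ∈ range (l + 1), ((2 * l + 1 - 2 * κ).factorial : ℝ) *
            ((∑ a ∈ range (l + 1), if e₀ ≤ a ∧ κ ≤ a then
                (-1 : ℝ) ^ (a - e₀) * (a.choose e₀ : ℝ) *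
                  ((∏ i ∈ range (2 * l + 1 - 2 * a), ((n : ℝ) - (2 * a : ℕ) - (2 * κ : ℕ) - i)) /
                    ((2 * l + 1 - 2 * a).factorial : ℝ)) *
                  (((((univ : Finset (Fin n)).filter fun x => x < π x).card - 2 * κ).choose (a - κ) : ℕ) : ℝ)
              else 0) *
              ∑ T ∈ univ.filter (fun T : Finset (Fin n) => (T.filter fun x => π x ∈ T).card = 2 * κ), p (2 * κ) T) := by
  obtain ⟨p, hp, hdec⟩ := exists_layer_decomposition hl X hX
  refine ⟨p, hp, fun π hinv hfix e₀ => ?_⟩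
  rw [card_filter_level_eq_sum_layers X hX p hdec π e₀]
  -- split the layer sum into even and odd degrees: odd layers vanish, even layers are (★)
  have hterm : ∀ j ∈ range (2 * l + 1 + 1), ((2 * l + 1 - j).factorial : ℝ) *
      ∑ U ∈ (powersetCard (2 * l + 1) (univ : Finset (Fin n))).filter
        (fun U => (U.filter fun x => x < π x ∧ π x ∈ U).card = e₀), zeta (p j) U =
      if Even j then ((2 * l + 1 - j).factorial : ℝ) *
        ((∑ a ∈ range (l + 1), if e₀ ≤ a ∧ j / 2 ≤ a then
            (-1 : ℝ) ^ (a - e₀) * (a.choose e₀ : ℝ) *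
              ((∏ i ∈ range (2 * l + 1 - 2 * a), ((n : ℝ) - (2 * a : ℕ) - (2 * (j / 2) : ℕ) - i)) /
                ((2 * l + 1 - 2 * a).factorial : ℝ)) *
              (((((univ : Finset (Fin n)).filter fun x => x < π x).card - 2 * (j / 2)).choose (a - j / 2) : ℕ) : ℝ)
          else 0) *
          ∑ T ∈ univ.filter (fun T : Finset (Fin n) => (T.filter fun x => π x ∈ T).card = 2 * (j / 2)), p (2 * (j / 2)) T)
      else 0 := by
    intro j hj
    rcases Nat.even_or_odd j with ⟨κ, hκ⟩ | hodd
    · have hj2 : j = 2 * κ := by omega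
      have hκj : j / 2 = κ := by omega
      rw [if_pos ⟨κ, hκ⟩, hκj]
      have hκn : 4 * κ ≤ n := by have := mem_range.1 hj; omega
      rw [hj2, level_column_sum_zeta_eq_of_even hinv hfix hκn (hp (2 * κ)) l e₀]
    · rw [if_neg (Nat.not_even_iff_odd.2 hodd),
        level_column_sum_zeta_eq_zero_of_odd hinv hfix hodd (hp j) l e₀, mul_zero]
  rw [sum_congr rfl hterm]
  -- reindex the even `j = 2κ`, `κ ≤ l`
  rw [← sum_filter]
  symm
  refine sum_nbij' (fun κ => 2 * κ) (fun j => j / 2) ?_ ?_ ?_ ?_ ?_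
  · intro κ hκ
    simp only [mem_range, mem_filter] at hκ ⊢
    exact ⟨by omega, ⟨κ, by ring⟩⟩
  · intro j hj
    simp only [mem_range, mem_filter] at hj ⊢
    obtain ⟨κ, hκ⟩ := hj.2
    omega
  · intro κ _; show 2 * κ / 2 = κ; omega
  · intro j hj
    simp only [mem_filter] at hj
    obtain ⟨κ, hκ⟩ := hj.2
    show 2 * (j / 2) = j; omega
  · intro κ _
    simp only [show 2 * κ / 2 = κ by omega]

end Summit.PneNP.PneNP.Theorems.ChebyshevTracialDesignRectangleBiMode
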